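import Mathlib
import Summits.NavierStokesRegularity.NavierStokesRegularity.Theorems.TaoLadderRungTwoBreakOneShiftWindowKrawczykSlope
import HarnessLib

/-!
# The one-shift window system, XIV: the PAIR SLOPE OF ONE STEP — slope rows from a derivative enclosure on a
# convex set (the centre flow), a slope matrix from a componentwise deviation bound (the rough-tail correction),
# and their assembly `U ∈ [J] + [−Xb, Xb]` (cell harvest/h2-tao-ladder, seat p2; rung1/KERNEL-CHEAP-REPLAY-SPEC.md
# §2 (e) (A := J + rem + [−Xb, Xb]) / §3 S2, rung1/RUNG1-P2G12-REPORT.md §54; support for K1(1) =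
# `NoSurvivingDSSOne`, stmt-NavierStokesRegularity-20205)

MODEL lattice ODEs only (Tao 2016 §4 normal form on Tao's shift set `S`); nothing here is a statement about
the Navier–Stokes equations; no item is closed; nothing numerical is proved. Everything in this file is
finite-dimensional and generic in the index type `ι` (window components); no ODE appears.

Part XIII (`exists_chainSlope`) composes PER-STEP PAIR SLOPES: for two solutions `S_u, S_v` of the window system
with the same (rough, merely Lipschitz-in-time) tails, a real matrix `U_s` inside the step's interval matrix
`[A_s]` with `S_u(t_{s+1}) − S_v(t_{s+1}) = U_s · (S_u(t_s) − S_v(t_s))`. The replay's `[A_s]` is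
`J + rem + [−Xb, Xb]` (SPEC §2 (e)): `J + rem ∋ DΦ_c(x)` for every `x` in the step box (the C¹ enclosure of the
CENTRE system — constant tails, an autonomous polynomial field, where `Literature.Analysis.ODE.VariationalEnclosure`
applies verbatim), and `Xb` a componentwise bound of the deviation of the rough-tail pair difference from the centre
pair difference (a Kapela–Zgliczyński estimate, `Literature.Analysis.ODE.ComponentwisePerturbation`, LINEAR in the
initial difference). This file is the assembly, with no differentiability asked of the rough-tail flow:

* `exists_slope_row_pi` — a slope ROW of a scalar function from its derivative within a convex set of `ι → ℝ`
  (mean value theorem on the segment; the row is the derivative at an intermediate point, in coordinates);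
* `exists_slopeMatrix_of_fderiv` — for a map `Φ` with `HasFDerivWithinAt Φ (Φ' x) s x` on a convex `s` and all
  derivative entries in `[CV, DV]` (the format of `hasFDerivWithinAt_flow_of_variationalEnclosure`), every pair
  `a, b ∈ s` has a slope matrix `M ∈ [CV, DV]` with `Φ a − Φ b = M · (a − b)` (rows at row-dependent points);
* `exists_slopeMatrix_of_abs_le` — the SIGN TRICK: a componentwise bound `|r_i| ≤ Σ_j X_ij |d_j|` (`X ≥ 0`) yields a
  real matrix `E` with `|E_ij| ≤ X_ij` and `r = E · d`;
* `exists_stepSlope` — assembly: centre slope `M ∈ [CV, DV]` with `w_c = M d`, deviation `|w − w_c|_i ≤ Σ_j Xb_ij |d_j|`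
  ⇒ `w = U d` with `U ∈ [CV − Xb, DV + Xb]` — the per-step hypothesis of `exists_chainSlope`.
-/

noncomputable section

-- the sub-problem namespace repeats the summit name by design (D-0017)
set_option linter.dupNamespace false

namespace Summit.NavierStokesRegularity.NavierStokesRegularity.Theorems

namespace DSSOneShift

open Set Metric

variable {ι : Type*} [Fintype ι] [DecidableEq ι]

/-! ### Slope rows from a derivative within a convex set -/

/-- Every vector of `ι → ℝ` is the coordinate combination of the `Pi.single` vectors. [folklore] -/
theorem sum_apply_smul_single (x : ι → ℝ) : ∑ j, x j • (Pi.single j (1 : ℝ) : ι → ℝ) = x := by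
  ext i
  simp [Finset.sum_apply, Pi.single_apply]

/-- **A slope ROW from a derivative within a convex set** (`ι → ℝ` version of part X
`exists_slope_row_of_hasFDerivWithinAt`): `φ a − φ b = Σ_j (φ' z)(e_j) · (a_j − b_j)` for an intermediate point
`z ∈ s` of the segment. [folklore] -/
theorem exists_slope_row_pi {s : Set (ι → ℝ)} (hs : Convex ℝ s) {φ : (ι → ℝ) → ℝ}
    {φ' : (ι → ℝ) → (ι → ℝ) →L[ℝ] ℝ} (hφ : ∀ x ∈ s, HasFDerivWithinAt φ (φ' x) s x) {a b : ι → ℝ}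
    (ha : a ∈ s) (hb : b ∈ s) :
    ∃ z ∈ s, φ a - φ b = ∑ j, (φ' z) (Pi.single j 1) * (a j - b j) := by
  set γ : ℝ → (ι → ℝ) := fun θ => b + θ • (a - b) with hγ
  have hγmem : ∀ θ ∈ Icc (0 : ℝ) 1, γ θ ∈ s := by
    intro θ hθ
    have := hs hb ha (sub_nonneg.2 hθ.2) hθ.1 (sub_add_cancel 1 θ)
    convert this using 1
    simp only [hγ, smul_sub]
    module
  have hγ0 : γ 0 = b := by simp [hγ]
  have hγ1 : γ 1 = a := by simp [hγ]
  have hγd : ∀ θ, HasDerivAt γ (a - b) θ := fun θ => by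
    simpa [hγ] using ((hasDerivAt_id θ).smul_const (a - b)).const_add b
  have hcomp : ∀ θ ∈ Icc (0 : ℝ) 1, HasDerivWithinAt (φ ∘ γ) ((φ' (γ θ)) (a - b)) (Icc 0 1) θ :=
    fun θ hθ => (hφ (γ θ) (hγmem θ hθ)).comp_hasDerivWithinAt θ (hγd θ).hasDerivWithinAt
      (fun θ' hθ' => hγmem θ' hθ')
  have hcont : ContinuousOn (φ ∘ γ) (Icc 0 1) := fun θ hθ => (hcomp θ hθ).continuousWithinAt
  have hderiv : ∀ θ ∈ Ioo (0 : ℝ) 1, HasDerivAt (φ ∘ γ) ((φ' (γ θ)) (a - b)) θ := fun θ hθ =>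
    (hcomp θ (Ioo_subset_Icc_self hθ)).hasDerivAt (Icc_mem_nhds hθ.1 hθ.2)
  obtain ⟨θ, hθ, hslope⟩ := exists_hasDerivAt_eq_slope (φ ∘ γ) (fun θ => (φ' (γ θ)) (a - b)) zero_lt_one
    hcont hderiv
  refine ⟨γ θ, hγmem θ (Ioo_subset_Icc_self hθ), ?_⟩
  have hval : φ a - φ b = (φ' (γ θ)) (a - b) := by
    have := hslope
    simp only [Function.comp_apply, hγ1, hγ0, sub_zero, div_one] at this
    exact this.symm
  rw [hval]
  conv_lhs => rw [← sum_apply_smul_single (a - b)]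
  simp only [map_sum, map_smul, smul_eq_mul, Pi.sub_apply]
  exact Finset.sum_congr rfl fun j _ => mul_comm _ _

/-- **A slope MATRIX from a derivative enclosure on a convex set.** If `Φ : (ι → ℝ) → (ι → ℝ)` has within the convex
set `s` a derivative `Φ' x` at every `x ∈ s` whose entries `(Φ' x)(e_j)_i` lie in `[CV i j, DV i j]` (the format of
`Literature.Analysis.ODE.hasFDerivWithinAt_flow_of_variationalEnclosure`), then any two points `a, b ∈ s` have a real
matrix `M ∈ [CV, DV]` with `Φ a − Φ b = M · (a − b)` (row `i` = the derivative row at an intermediate point of the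
segment depending on `i`). [folklore; cite: WalawskaWilczak2016, §1.1 (ψ = D_xφ·V)] -/
theorem exists_slopeMatrix_of_fderiv {s : Set (ι → ℝ)} (hs : Convex ℝ s) {Φ : (ι → ℝ) → ι → ℝ}
    {Φ' : (ι → ℝ) → (ι → ℝ) →L[ℝ] (ι → ℝ)} (hΦ : ∀ x ∈ s, HasFDerivWithinAt Φ (Φ' x) s x)
    {CV DV : ι → ι → ℝ} (henc : ∀ x ∈ s, ∀ i j, CV i j ≤ (Φ' x) (Pi.single j 1) i ∧ (Φ' x) (Pi.single j 1) i ≤ DV i j)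
    {a b : ι → ℝ} (ha : a ∈ s) (hb : b ∈ s) :
    ∃ M : Matrix ι ι ℝ, (∀ i j, CV i j ≤ M i j ∧ M i j ≤ DV i j) ∧ Φ a - Φ b = M.mulVec (a - b) := by
  -- row by row
  have hrow : ∀ i, ∃ z ∈ s, Φ a i - Φ b i = ∑ j, (Φ' z) (Pi.single j 1) i * (a j - b j) := by
    intro i
    have hφ : ∀ x ∈ s, HasFDerivWithinAt (fun y => Φ y i) ((ContinuousLinearMap.proj i).comp (Φ' x)) s x :=
      fun x hx => (hasFDerivWithinAt_pi'.1 (hΦ x hx)) i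
    obtain ⟨z, hz, h⟩ := exists_slope_row_pi hs hφ ha hb
    exact ⟨z, hz, by simpa using h⟩
  choose z hz hrep using hrow
  refine ⟨Matrix.of fun i j => (Φ' (z i)) (Pi.single j 1) i, fun i j => ?_, ?_⟩
  · simpa using henc (z i) (hz i) i j
  · ext i
    rw [Pi.sub_apply, hrep i, Matrix.mulVec, dotProduct]
    simp [Matrix.of_apply]

/-! ### A slope matrix from a componentwise deviation bound (the sign trick) -/

omit [DecidableEq ι] in
/-- **THE SIGN TRICK.** A componentwise bound `|r_i| ≤ Σ_j X_ij |d_j|` with `X ≥ 0` is realised by a real matrix: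
there is `E` with `|E_ij| ≤ X_ij` and `r = E · d` (take `E_ij = r_i X_ij σ_j / Σ_j X_ij |d_j|` with `σ_j d_j = |d_j|`).
This turns a Grönwall / Kapela–Zgliczyński deviation estimate that is LINEAR in the initial difference into a
slope matrix, with no differentiability involved. [folklore; cite: KapelaZgliczynski2009, §4 Lemma 8 / Thm. 9 (the componentwise estimates it converts)] -/
theorem exists_slopeMatrix_of_abs_le (r d : ι → ℝ) (X : ι → ι → ℝ) (hX : ∀ i j, 0 ≤ X i j)
    (h : ∀ i, |r i| ≤ ∑ j, X i j * |d j|) :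
    ∃ E : Matrix ι ι ℝ, (∀ i j, |E i j| ≤ X i j) ∧ r = E.mulVec d := by
  classical
  -- signs with `σ_j d_j = |d_j|`
  set σ : ι → ℝ := fun j => if 0 ≤ d j then 1 else -1 with hσ
  have hσd : ∀ j, σ j * d j = |d j| := fun j => by
    by_cases hj : 0 ≤ d j
    · simp [hσ, hj, abs_of_nonneg hj]
    · simp [hσ, hj, abs_of_neg (not_le.1 hj)]
  have hσ1 : ∀ j, |σ j| = 1 := fun j => by by_cases hj : 0 ≤ d j <;> simp [hσ, hj]
  set S : ι → ℝ := fun i => ∑ j, X i j * |d j| with hS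
  have hS0 : ∀ i, 0 ≤ S i := fun i => Finset.sum_nonneg fun j _ => mul_nonneg (hX i j) (abs_nonneg _)
  refine ⟨Matrix.of fun i j => if S i = 0 then 0 else r i * X i j * σ j / S i, fun i j => ?_, ?_⟩
  · simp only [Matrix.of_apply]
    by_cases hSi : S i = 0
    · simp [hSi, hX i j]
    · rw [if_neg hSi, abs_div, abs_mul, abs_mul, hσ1, mul_one, abs_of_nonneg (hX i j), abs_of_nonneg (hS0 i),
        div_le_iff₀ (lt_of_le_of_ne (hS0 i) (Ne.symm hSi))]
      calc |r i| * X i j ≤ S i * X i j := mul_le_mul_of_nonneg_right (h i) (hX i j)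
        _ = X i j * S i := mul_comm _ _
  · ext i
    simp only [Matrix.mulVec, dotProduct, Matrix.of_apply]
    by_cases hSi : S i = 0
    · -- then `r i = 0`
      have hri : r i = 0 := abs_eq_zero.1 (le_antisymm ((h i).trans_eq hSi) (abs_nonneg _))
      simp [hSi, hri]
    · simp only [if_neg hSi]
      have e : ∑ j, r i * X i j * σ j / S i * d j = r i * (∑ j, X i j * (σ j * d j)) / S i := by
        rw [Finset.mul_sum, Finset.sum_div]
        exact Finset.sum_congr rfl fun j _ => by ring
      rw [e]
      simp_rw [hσd]
      show r i = r i * S i / S i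
      rw [mul_div_cancel_right₀ _ hSi]

/-! ### Assembly: the pair slope of one step -/

omit [DecidableEq ι] in
/-- **THE PAIR SLOPE OF ONE STEP.** Let `d` be the difference of two solutions at the start of a step, `w` their
difference at its end, and `w_c = M · d` the difference of the two CENTRE solutions from the same two starting
points, with `M ∈ [CV, DV]` (a slope matrix of the centre step flow, `exists_slopeMatrix_of_fderiv`). If the
deviation satisfies `|w − w_c|_i ≤ Σ_j Xb_ij |d_j|` with `Xb ≥ 0` (the rough-tail / inclusion correction, linear in
`d`), then `w = U · d` for a real matrix `U ∈ [CV − Xb, DV + Xb]` — the per-step hypothesis of part XIII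
`exists_chainSlope` with the replay's `[A_s] = J + rem + [−Xb, Xb]`.
[cite: Tao2016AveragedNS, §5.3; cell vocabulary, harvest/h2-tao-ladder rung1/KERNEL-CHEAP-REPLAY-SPEC.md §2 (e), rung1/RUNG1-P2G12-REPORT.md §54] -/
theorem exists_stepSlope (d w wc : ι → ℝ) {M : Matrix ι ι ℝ} {CV DV Xb : ι → ι → ℝ}
    (hM : ∀ i j, CV i j ≤ M i j ∧ M i j ≤ DV i j) (hwc : wc = M.mulVec d) (hXb : ∀ i j, 0 ≤ Xb i j)
    (hdev : ∀ i, |w i - wc i| ≤ ∑ j, Xb i j * |d j|) :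
    ∃ U : Matrix ι ι ℝ, (∀ i j, CV i j - Xb i j ≤ U i j ∧ U i j ≤ DV i j + Xb i j) ∧ w = U.mulVec d := by
  obtain ⟨E, hE, hr⟩ := exists_slopeMatrix_of_abs_le (fun i => w i - wc i) d Xb hXb hdev
  refine ⟨M + E, fun i j => ?_, ?_⟩
  · have h1 := hM i j
    have h2 := abs_le.1 (hE i j)
    simp only [Matrix.add_apply]
    constructor <;> linarith [h2.1, h2.2]
  · rw [Matrix.add_mulVec, ← hwc]
    have : w = wc + (fun i => w i - wc i) := by ext i; simp
    rw [this, hr]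

/-! ### The same slope rows, with the intermediate points ON THE SEGMENT (needed to bound `|A − A_c|` in part XV) -/

/-- **A slope ROW at a point of the SEGMENT.** As `exists_slope_row_pi`, recording that the intermediate point lies on
`segment ℝ a b` (so its distance to any point of another segment is controlled by the endpoints). [folklore] -/
theorem exists_slope_row_pi_segment {s : Set (ι → ℝ)} (hs : Convex ℝ s) {φ : (ι → ℝ) → ℝ}
    {φ' : (ι → ℝ) → (ι → ℝ) →L[ℝ] ℝ} (hφ : ∀ x ∈ s, HasFDerivWithinAt φ (φ' x) s x) {a b : ι → ℝ}
    (ha : a ∈ s) (hb : b ∈ s) :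
    ∃ z ∈ segment ℝ a b, φ a - φ b = ∑ j, (φ' z) (Pi.single j 1) * (a j - b j) := by
  set γ : ℝ → (ι → ℝ) := fun θ => b + θ • (a - b) with hγ
  have hγseg : ∀ θ ∈ Icc (0 : ℝ) 1, γ θ ∈ segment ℝ a b := by
    intro θ hθ
    rw [segment_symm]
    refine ⟨1 - θ, θ, sub_nonneg.2 hθ.2, hθ.1, sub_add_cancel 1 θ, ?_⟩
    simp only [hγ, smul_sub]
    module
  have hγmem : ∀ θ ∈ Icc (0 : ℝ) 1, γ θ ∈ s := fun θ hθ => hs.segment_subset ha hb (hγseg θ hθ)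
  have hγ0 : γ 0 = b := by simp [hγ]
  have hγ1 : γ 1 = a := by simp [hγ]
  have hγd : ∀ θ, HasDerivAt γ (a - b) θ := fun θ => by
    simpa [hγ] using ((hasDerivAt_id θ).smul_const (a - b)).const_add b
  have hcomp : ∀ θ ∈ Icc (0 : ℝ) 1, HasDerivWithinAt (φ ∘ γ) ((φ' (γ θ)) (a - b)) (Icc 0 1) θ :=
    fun θ hθ => (hφ (γ θ) (hγmem θ hθ)).comp_hasDerivWithinAt θ (hγd θ).hasDerivWithinAt
      (fun θ' hθ' => hγmem θ' hθ')
  have hcont : ContinuousOn (φ ∘ γ) (Icc 0 1) := fun θ hθ => (hcomp θ hθ).continuousWithinAt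
  have hderiv : ∀ θ ∈ Ioo (0 : ℝ) 1, HasDerivAt (φ ∘ γ) ((φ' (γ θ)) (a - b)) θ := fun θ hθ =>
    (hcomp θ (Ioo_subset_Icc_self hθ)).hasDerivAt (Icc_mem_nhds hθ.1 hθ.2)
  obtain ⟨θ, hθ, hslope⟩ := exists_hasDerivAt_eq_slope (φ ∘ γ) (fun θ => (φ' (γ θ)) (a - b)) zero_lt_one
    hcont hderiv
  refine ⟨γ θ, hγseg θ (Ioo_subset_Icc_self hθ), ?_⟩
  have hval : φ a - φ b = (φ' (γ θ)) (a - b) := by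
    have := hslope
    simp only [Function.comp_apply, hγ1, hγ0, sub_zero, div_one] at this
    exact this.symm
  rw [hval]
  conv_lhs => rw [← sum_apply_smul_single (a - b)]
  simp only [map_sum, map_smul, smul_eq_mul, Pi.sub_apply]
  exact Finset.sum_congr rfl fun j _ => mul_comm _ _

/-- **A slope MATRIX with its row points on the segment**: `Φ a − Φ b = M (a − b)` with
`M_ij = (Φ' (z_i))(e_j)_i` for points `z_i ∈ segment ℝ a b` (one per row). The closeness of two such matrices for two
nearby segments (rough-tail pair vs centre pair at the same time) is then a Lipschitz bound of `Φ'` — the `AΔ` of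
part XV. [folklore; cite: WalawskaWilczak2016, §1.1] -/
theorem exists_slopeMatrix_rows_on_segment {s : Set (ι → ℝ)} (hs : Convex ℝ s) {Φ : (ι → ℝ) → ι → ℝ}
    {Φ' : (ι → ℝ) → (ι → ℝ) →L[ℝ] (ι → ℝ)} (hΦ : ∀ x ∈ s, HasFDerivWithinAt Φ (Φ' x) s x) {a b : ι → ℝ}
    (ha : a ∈ s) (hb : b ∈ s) :
    ∃ z : ι → (ι → ℝ), (∀ i, z i ∈ segment ℝ a b) ∧
      Φ a - Φ b = (Matrix.of fun i j => (Φ' (z i)) (Pi.single j 1) i).mulVec (a - b) := by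
  have hrow : ∀ i, ∃ z ∈ segment ℝ a b, Φ a i - Φ b i = ∑ j, (Φ' z) (Pi.single j 1) i * (a j - b j) := by
    intro i
    have hφ : ∀ x ∈ s, HasFDerivWithinAt (fun y => Φ y i) ((ContinuousLinearMap.proj i).comp (Φ' x)) s x :=
      fun x hx => (hasFDerivWithinAt_pi'.1 (hΦ x hx)) i
    obtain ⟨z, hz, h⟩ := exists_slope_row_pi_segment hs hφ ha hb
    exact ⟨z, hz, by simpa using h⟩
  choose z hz hrep using hrow
  refine ⟨z, hz, ?_⟩
  ext i
  rw [Pi.sub_apply, hrep i, Matrix.mulVec, dotProduct]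
  simp [Matrix.of_apply]

end DSSOneShift

end Summit.NavierStokesRegularity.NavierStokesRegularity.Theorems
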